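import Literature.ModelTheory.Zilber.EACMultiSwap
import Summits.Schanuel.Schanuel.Theorems.ZilberEacTorusRuled
import HarnessLib

/-!
# Torus-ruled varieties, V: ruling by a subtorus of any rank (all cells `(n, d)`)

Zilber's Exponential-Algebraic Closedness, case ladder (host summit Schanuel, cell `pub-schanuel`,
seat 2, gen 4).  Theorem A of `ZilberEacTorusRuled.lean` treats ONE ruling direction `ν` and needs
`π(V) + ℂν` dense — possible only when the base has codimension `≤ 1`.  For the cells `(n, d)` with
`d ≤ n - 2` (open for `n ≥ 4`, `2 ≤ d`) the natural hypothesis is ruling by a subtorus of rank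
`n - d`.  Here: **Theorem A_Λ** (`inter_expGraph_nonempty_of_isTorusStable_lattice`) — let
`U, V ∈ GLₙ(ℤ)` be an inverse pair and `I` a set of indices; if the torus part of the irreducible
`W` is additively free and stable under the one-parameter subtori in the directions `V eᵢ` (`i ∈ I`,
the columns of `V` indexed by `I` — any family of lattice vectors extendable to a basis of `ℤⁿ`
arises this way), and `π(V) + Σ_{i∈I} ℂ·(V eᵢ)` is Zariski dense in `ℂⁿ`, then `W ∩ Γ_exp ≠ ∅`.
Proof: transport by `Φ_U` (the directions become the coordinate vectors `eᵢ`, `i ∈ I`) and apply the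
coordinate case `inter_expGraph_nonempty_of_isTorusStable_coords` (`EACMultiSwap`: simultaneous
cylinders + the multi-coordinate swap + Aslanyan–Kirby–Mantova Thm. 1.5).

Honest framing: a corollary of a published theorem by coordinate changes; no open cell is settled;
`ECCell 3 2` OPEN; not Schanuel's conjecture; EAC ⇏ SC.
-/

noncomputable section

open MvPolynomial Matrix
open Literature.NumberTheory.Transcendental Literature.ModelTheory.Zilber

set_option linter.dupNamespace false

namespace Summit.Schanuel.Schanuel.Theorems

variable {n : ℕ}

/-- Overwriting the coordinates in `I` of `U x` is the same as adding to `U x` a combination of the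
`eᵢ`, `i ∈ I`: `U(x + Σ_{i∈I} cᵢ V eᵢ) = ` "`U x` with `i`-th coordinate `(U x)ᵢ + cᵢ`" for an
inverse pair. [folklore] -/
theorem intLinMap_add_sum_smul_col {U V : Matrix (Fin n) (Fin n) ℤ} (hUV : U * V = 1)
    (I : Finset (Fin n)) (x : Fin n → ℂ) (c : Fin n → ℂ) :
    intLinMap U (x + ∑ i ∈ I, c i • fun j => ((V *ᵥ Pi.single i 1) j : ℂ)) =
      fun j => if j ∈ I then intLinMap U x j + c j else intLinMap U x j := by
  classical
  rw [intLinMap_add]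
  have hsum : intLinMap U (∑ i ∈ I, c i • fun j => ((V *ᵥ Pi.single i 1) j : ℂ)) =
      ∑ i ∈ I, c i • fun j => (((U * V) *ᵥ Pi.single i 1) j : ℂ) := by
    induction I using Finset.induction_on with
    | empty =>
      simp only [Finset.sum_empty]
      funext j
      simp [intLinMap]
    | insert i s hi ih =>
      rw [Finset.sum_insert hi, Finset.sum_insert hi, intLinMap_add, ih, intLinMap_smul_intCast,
        Matrix.mulVec_mulVec]
  rw [hsum, hUV]
  funext j
  simp only [Pi.add_apply, Finset.sum_apply, Pi.smul_apply, smul_eq_mul, Matrix.one_mulVec]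
  by_cases hj : j ∈ I
  · rw [if_pos hj, Finset.sum_eq_single j]
    · simp
    · intro i _ hij
      simp [Pi.single_eq_of_ne (Ne.symm hij)]
    · intro h
      exact absurd hj h
  · rw [if_neg hj, Finset.sum_eq_zero, add_zero]
    intro i hi
    have hij : j ≠ i := fun h => hj (h ▸ hi)
    simp [Pi.single_eq_of_ne hij]

/-- **Theorem A_Λ (ruling by a subtorus of any rank).** Let `U, V ∈ Matₙ(ℤ)` be an inverse pair,
`I` a set of indices, `W ⊆ ℂⁿ × ℂⁿ` irreducible closed with `W ∩ Gⁿ ≠ ∅` additively free and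
stable under `y ↦ y · t^{V eᵢ}` for every `i ∈ I`, and suppose `π(W ∩ Gⁿ) + Σ_{i∈I} ℂ·(V eᵢ)` is
Zariski dense in `ℂⁿ`. Then `W` meets the graph of `exp`. (For a cell `(n, d)` take `|I| = n - d`:
the torus part is ruled by a rank-`(n-d)` subtorus in basis-extendable directions and the base is
transversal to them.) [cite: AslanyanKirbyMantova2021, Thm. 1.5] -/
theorem inter_expGraph_nonempty_of_isTorusStable_lattice {W : Set (Fin n ⊕ Fin n → ℂ)}
    (hW : IsIrreducibleClosed ℂ W) (hne : (W ∩ torusLocus ℂ n).Nonempty)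
    (hadd : IsAddFree ℂ n (W ∩ torusLocus ℂ n)) {U V : Matrix (Fin n) (Fin n) ℤ} (hUV : U * V = 1)
    (hVU : V * U = 1) (I : Finset (Fin n))
    (hst : ∀ i ∈ I, IsTorusStable (V *ᵥ Pi.single i 1) (W ∩ torusLocus ℂ n))
    (hdense : ∀ p : MvPolynomial (Fin n) ℂ,
      (∀ z ∈ W ∩ torusLocus ℂ n, ∀ c : Fin n → ℂ,
        eval (projAdd z + ∑ i ∈ I, c i • fun j => ((V *ᵥ Pi.single i 1) j : ℂ)) p = 0) → p = 0) :
    (W ∩ expGraph ℂ n).Nonempty := by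
  classical
  have hW' := isIrreducibleClosed_latticeClosure U hW hne
  have hne' := latticeClosure_inter_torusLocus_nonempty U hne
  have hT : latticeClosure U W ∩ torusLocus ℂ n = latticeImage U W :=
    latticeClosure_inter_torusLocus hUV hVU hW.1
  have hadd' : IsAddFree ℂ n (latticeClosure U W ∩ torusLocus ℂ n) := by
    rw [hT]
    exact isAddFree_latticeImage hUV hadd
  -- the ruling directions become the coordinate vectors
  have hst' : ∀ i ∈ I, IsTorusStable (Pi.single i 1) (latticeClosure U W ∩ torusLocus ℂ n) := by
    intro i hi
    rw [hT]
    have h := isTorusStable_latticeImage U (hst i hi)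
    rwa [Matrix.mulVec_mulVec, hUV, Matrix.one_mulVec] at h
  -- density transports to the coordinate form
  have hoff : HasDominantAddProjectionOffSet ℂ I (latticeClosure U W ∩ torusLocus ℂ n) := by
    intro p hp
    have hq : linSubst U p = 0 := by
      refine hdense _ fun z hz c => ?_
      rw [eval_linSubst, intLinMap_add_sum_smul_col hUV]
      have hz' : latticeChange U z ∈ latticeClosure U W ∩ torusLocus ℂ n := by
        rw [hT]
        exact ⟨z, hz, rfl⟩
      have h := hp _ hz' fun j => intLinMap U (projAdd z) j + c j
      have hfun : (fun j => if j ∈ I then (fun j => intLinMap U (projAdd z) j + c j) j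
          else projAdd (latticeChange U z) j) =
          fun j => if j ∈ I then intLinMap U (projAdd z) j + c j else intLinMap U (projAdd z) j := by
        funext j
        split_ifs
        · rfl
        · rfl
      rw [hfun] at h
      exact h
    have : linSubst V (linSubst U p) = p := by
      rw [← AlgHom.comp_apply, linSubst_comp, hUV, linSubst_one, AlgHom.id_apply]
    rw [← this, hq, map_zero]
  have h := inter_expGraph_nonempty_of_isTorusStable_coords hW' hne' hadd' hst' hoff
  rwa [latticeClosure_inter_expGraph hUV hVU hW.1, latticeImage_inter_expGraph_nonempty_iff hVU] at h

end Summit.Schanuel.Schanuel.Theorems
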